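import Summits.NavierStokesRegularity.FluidComputer.AngularGalerkinLadder
import HarnessLib

/-!
# Degenerate instances of the scale-invariant defect bound — KJ-22 support for K3a `LocalCompactness`

Negative-lane helpers (refuter lineage `ns-blowup-refuter`, g14; supports
`stmt-NavierStokesRegularity-19856`).  No route file is imported; nothing asserts a Theses declaration.

The K3a engine skeleton of record (`Cruxes/LocalCompactness/Lines/engine.lean`, sha16 53124114230f7e93,
lean g11) has stub A `stub_forcedOseenMild_remainder : … IsWindowProfile L C₀ cmin cmax δ ε c R u p d →
0 ≤ ε → ‖ρ‖ ≤ ε·K s t ∧ …`.  Two bookkeeping facts used in the refuter's junk-read KJ-22 (memo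
`KJ22-K3A-ENGINE-STUBS-READ.md`, evidence #2 on 19856):

* `hasDefectBound_zero_iff` — at `ε = 0` the defect VANISHES on the open past, so stub A at `ε = 0`
  asserts exact Oseen-mildness of every classical Type-I rung profile (genuine content: gauge fixing,
  KNSS 2009 Lemma 3.1), not a triviality;
* `HasDefectBound.nonneg` — the bound at one point forces `0 ≤ ε`, so stub A's separate hypothesis
  `0 ≤ ε` is implied by `IsWindowProfile` (decoration, harmless); `hasDefectBound_neg_iff_false`.
[cite: KochNadirashviliSereginSverak2009, (1.6)]
-/

open Set

namespace Summit.NavierStokesRegularity.LocalCompactnessDefectBoundDegenerate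

open Summit.NavierStokesRegularity.FluidComputer.AngularLadder

/-- The scale-invariant defect bound at a single point of the open past forces `0 ≤ ε`. -/
theorem HasDefectBound.nonneg {ε : ℝ}
    {d : ℝ → EuclideanSpace ℝ (Fin 3) → EuclideanSpace ℝ (Fin 3)} (h : HasDefectBound ε d) :
    0 ≤ ε := by
  have h1 := h (-1) (by norm_num) 0
  rw [norm_zero, zero_add, neg_neg, Real.sqrt_one, one_pow, div_one] at h1
  exact (norm_nonneg _).trans h1

/-- A negative `ε` admits no defect at all. -/
theorem hasDefectBound_neg_iff_false {ε : ℝ} (hε : ε < 0)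
    (d : ℝ → EuclideanSpace ℝ (Fin 3) → EuclideanSpace ℝ (Fin 3)) : HasDefectBound ε d ↔ False :=
  ⟨fun h => absurd (HasDefectBound.nonneg h) (not_le.mpr hε), False.elim⟩

/-- **`ε = 0` means NO defect on the open past**: `HasDefectBound 0 d ↔ ∀ t < 0, ∀ x, d t x = 0`.  So the
`ε = 0` instance of stub A of the K3a engine says that every classical Type-I rung profile is EXACTLY
Oseen-mild — the gauge-fixing content, not a vacuous or trivial instance. -/
theorem hasDefectBound_zero_iff (d : ℝ → EuclideanSpace ℝ (Fin 3) → EuclideanSpace ℝ (Fin 3)) :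
    HasDefectBound 0 d ↔ ∀ t < 0, ∀ x, d t x = 0 := by
  constructor
  · intro h t ht x
    have h1 := h t ht x
    rw [zero_div] at h1
    exact norm_le_zero_iff.mp h1
  · intro h t ht x
    rw [h t ht x, norm_zero, zero_div]

/-- The window predicate already carries `0 ≤ ε` (through its defect bound): stub A's extra hypothesis
`0 ≤ ε` is decoration. -/
theorem IsWindowProfile.defect_nonneg {L : ℕ} {C₀ cmin cmax δ ε c : ℝ}
    {R : EuclideanSpace ℝ (Fin 3) ≃ₗᵢ[ℝ] EuclideanSpace ℝ (Fin 3)}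
    {u : ℝ → EuclideanSpace ℝ (Fin 3) → EuclideanSpace ℝ (Fin 3)}
    {p : ℝ → EuclideanSpace ℝ (Fin 3) → ℝ}
    {d : ℝ → EuclideanSpace ℝ (Fin 3) → EuclideanSpace ℝ (Fin 3)}
    (h : IsWindowProfile L C₀ cmin cmax δ ε c R u p d) : 0 ≤ ε :=
  HasDefectBound.nonneg h.2.2.2.2

end Summit.NavierStokesRegularity.LocalCompactnessDefectBoundDegenerate
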